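import Literature.Computability.Complexity.IWAmpCircuit
import Literature.Computability.MetaComplexity.NWPseudorandom
import HarnessLib

/-!
# Mild-to-strong hardness amplification at the level of one Boolean function
# (Impagliazzo–Wigderson / Healy–Vadhan–Viola, parametric form for the polynomial regime)

Literature / circuit complexity — derandomization. The tree's derandomized XOR lemma in circuit form,
`IWAmpBridge.exists_circuit_of_agree` (`IWAmpCircuit.lean`; Hirahara 2022, Lemma 8.1 after
Healy–Vadhan–Viola: a circuit agreeing with `Amp^f = f^{⊕k} ∘ (ND ⊕ Hit)` on `1/2 + ε` of the seeds yields
a circuit for `f` with fewer than `δ 2ᴺ` errors), is consumed in `IWStrongHardness.lean` for LANGUAGES in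
the exponential regime (`impagliazzo_wigderson`). The polynomial regime of hardness versus randomness —
the pseudorandom generator from a worst-case-hard TRUTH TABLE of IKW's Theorem 11 ([BFNW93, KM99];
`HardnessVsRandomness.lean`, `IKWGeneratorsProofs.lean`) — needs the same step for a single function with
all parameters free. This file provides it:

* `IWAmpFn.sidx`, `IWAmpFn.parseSeed` (+ `encSeed_parseSeed`, `parseSeed_encSeed`, `card_seed`) — seeds
  `(x, (t, b))` of `IWAmp.Seed N d m` as `d + ((N + m) + N)` bits, generically in `N d m` (the copies in
  `IWStrongLanguage.lean` are tied to that file's parameter functions);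
* `IWAmpFn.ampFn e idx f` — **the amplified function on bit vectors**, `u ↦ Amp^f(parse u)`;
* **`IWAmpFn.avgHardAtLeast_ampFn`** — if every `B₂`-circuit of size
  `≤ (2C² + 1) · predSize d k S maxT + 9C² + 3` errs on at least `δ 2ᴺ` inputs of `f` (MILD hardness), the
  hitter indexing is injective, every block reads `≤ maxT` positions of every other, `6 S ≤ k δ` and
  `2 k S ≤ C δ`, then `H_avg(ampFn) ≥ S` (`AvgHardAtLeast`, `NWPseudorandom.lean`: every circuit of size
  `≤ S` agrees with `ampFn` on fewer than `1/2 + 1/S` of the inputs) — the contrapositive of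
  `exists_circuit_of_agree` at `ε = 1/S`, the attacker transported to the seeds (`card_agree_seed`).

Everything is proved. Mathlib has none of this; nothing duplicates the tree (searched `ampFn`,
`avgHardAtLeast_amp`, `parseSeed`: only the parameter-specific `IWStrong.parseSeed`).

## References

* R. Impagliazzo, A. Wigderson, *P = BPP if E requires exponential circuits: derandomizing the XOR lemma*,
  STOC 1997, Thm. 1 [ImpagliazzoWigderson1997].
* S. Hirahara, *NP-hardness of learning programs and partial MCSP*, ECCC TR22-119 (2022), Lemma 8.1
  [Hirahara2022PartialMCSP].
* A. Healy, S. Vadhan, E. Viola, *Using nondeterminism to amplify hardness*, SIAM J. Comput. 35 (2006), §5.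
* R. Impagliazzo, V. Kabanets, A. Wigderson, *In search of an easy witness*, JCSS 65 (2002), Thm. 11
  [ImpagliazzoKabanetsWigderson2002].
-/

noncomputable section

namespace Literature.Computability.Complexity

open Finset MetaComplexity IWAmpBridge

namespace IWAmpFn

variable (N d m : ℕ)

/-! ### Seeds as bit vectors, generically -/

/-- The bit positions of a seed: `d` bits of `x`, then `N + m` and `N` bits of the Hankel seed. [folklore] -/
def sidx : Fin d ⊕ HBits N m ≃ Fin (d + ((N + m) + N)) :=
  (Equiv.sumCongr (Equiv.refl _) finSumFinEquiv).trans finSumFinEquiv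

/-- A bit as an element of `𝔽₂`. [folklore] -/
def bz (v : Bool) : ZMod 2 := if v then 1 else 0

variable {N d m}

/-- **Parsing** `d + ((N + m) + N)` bits into a seed `(x, (t, b))`. [folklore] -/
def parseSeed (u : Fin (d + ((N + m) + N)) → Bool) : IWAmp.Seed N d m :=
  (fun p => u (sidx N d m (.inl p)),
    (fun c => bz (u (sidx N d m (.inr (.inl c)))), fun r => bz (u (sidx N d m (.inr (.inr r))))))

/-- The bits of a parsed seed are the bits read. [folklore] -/
theorem encSeed_parseSeed (u : Fin (d + ((N + m) + N)) → Bool) :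
    encSeed (parseSeed u) = u ∘ sidx N d m := by
  funext p
  rcases p with p | c | r <;> simp [encSeed, encHankel, parseSeed, bz]

/-- Parsing the bits of a seed returns the seed. [folklore] -/
theorem parseSeed_encSeed (σ : IWAmp.Seed N d m) : parseSeed (encSeed σ ∘ (sidx N d m).symm) = σ := by
  obtain ⟨x, tt, bb⟩ := σ
  simp only [parseSeed, Function.comp_apply, Equiv.symm_apply_apply, encSeed, encHankel, Sum.elim_inl,
    Sum.elim_inr]
  refine Prod.ext rfl (Prod.ext ?_ ?_) <;> funext c <;> simp only [bz] <;>
    rcases (show (∀ z : ZMod 2, z = 0 ∨ z = 1) from by decide) (by first | exact tt c | exact bb c) with h | h <;>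
      simp [h]

/-- `encSeed` (read through `sidx`) is injective. [folklore] -/
theorem encSeed_injective : Function.Injective (encSeed (N := N) (d := d) (m := m)) := by
  intro σ σ' h
  rw [← parseSeed_encSeed σ, ← parseSeed_encSeed σ', h]

/-- The number of seeds is `2^{d + ((N + m) + N)}`. [folklore] -/
theorem card_seed : Fintype.card (IWAmp.Seed N d m) = 2 ^ (d + ((N + m) + N)) := by
  simp only [IWAmp.Seed, Hankel.Seed, Fintype.card_prod, Fintype.card_fun, Fintype.card_bool, Fintype.card_fin,
    ZMod.card]
  ring

/-! ### The amplified function on bit vectors -/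

variable {k : ℕ} (e : Fin k → (Fin N ↪ Fin d)) (idx : Fin k → Fin m → ZMod 2) (f : (Fin N → Bool) → Bool)

/-- **The amplified function on bit vectors**: `ampFn e idx f u = Amp^f(parse u) = ⊕ᵢ f(x|_{Sᵢ} ⊕ Hit(y)ᵢ)`.
[cite: Hirahara2022PartialMCSP, proof of Lemma 8.1 (the code Amp)] -/
def ampFn (u : Fin (d + ((N + m) + N)) → Bool) : Bool := IWAmp.amp e idx f (parseSeed u)

/-- The received word on seed bits defined by a circuit on the `d + ((N+m)+N)` bits. [folklore] -/
def Gb (C' : Circuit (Fin (d + ((N + m) + N)))) (s : Fin d ⊕ HBits N m → Bool) : Bool :=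
  C'.eval fun j => s ((sidx N d m).symm j)

/-- **Agreements transfer to the seeds**: the seeds on which the received word agrees with `Amp^f` are in
bijection with the bit vectors on which the circuit agrees with `ampFn`. [folklore] -/
theorem card_agree_seed (C' : Circuit (Fin (d + ((N + m) + N)))) :
    ((Finset.univ.filter fun σ : IWAmp.Seed N d m => Gb C' (encSeed σ) = IWAmp.amp e idx f σ).card) =
      (Finset.univ.filter fun u : Fin (d + ((N + m) + N)) → Bool => C'.eval u = ampFn e idx f u).card := by
  classical
  refine Finset.card_bij (fun σ _ => fun j => encSeed σ ((sidx N d m).symm j)) (fun σ hσ => ?_)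
    (fun σ₁ _ σ₂ _ h => ?_) (fun u hu => ?_)
  · rw [mem_filter] at hσ ⊢
    refine ⟨mem_univ _, ?_⟩
    have h1 : ampFn e idx f (fun j => encSeed σ ((sidx N d m).symm j)) = IWAmp.amp e idx f σ :=
      congrArg _ (parseSeed_encSeed σ)
    rw [h1]
    exact hσ.2
  · exact encSeed_injective (funext fun p => by simpa using congrFun h (sidx N d m p))
  · refine ⟨parseSeed u, ?_, ?_⟩
    · rw [mem_filter] at hu ⊢
      refine ⟨mem_univ _, ?_⟩
      have h2 : (fun j => encSeed (parseSeed u) ((sidx N d m).symm j)) = u := by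
        funext j; rw [encSeed_parseSeed]; simp
      unfold Gb
      rw [h2, hu.2]
      rfl
    · funext j; rw [encSeed_parseSeed]; simp

/-- **Mild-to-strong amplification for one function** (Impagliazzo–Wigderson 1997, Thm. 1, in the
parametric circuit form of the tree's derandomized XOR lemma): if every `B₂`-circuit on `N` inputs of
size `≤ (2C² + 1) · predSize d k S maxT + 9C² + 3` errs on at least `δ 2ᴺ` inputs of `f`, the hitter
indexing is injective, every block reads `≤ maxT` positions of every other, `6 S ≤ k δ` and `2 k S ≤ C δ`,
then `H_avg(ampFn e idx f) ≥ S`: a circuit of size `≤ S` agreeing with `ampFn` on a `1/2 + 1/S` fraction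
of the bit vectors would be a received word agreeing with `Amp^f` on as many seeds, decodable
(`exists_circuit_of_agree`, `ε = 1/S`) into a too good circuit for `f`.
[cite: ImpagliazzoWigderson1997, Thm. 1] [cite: Hirahara2022PartialMCSP, Lemma 8.1] -/
theorem avgHardAtLeast_ampFn (hidx : Function.Injective idx) {δ : ℝ} (hδ : 0 < δ) {S : ℕ} (hS : 0 < S)
    (hk : 6 * (S : ℝ) ≤ k * δ) {C : ℕ} (hC : 2 * k * (S : ℝ) ≤ C * δ) {maxT : ℕ}
    (hT : ∀ i j, Fintype.card (IWAmp.Tsub e i j) ≤ maxT)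
    (hmild : ∀ K : Circuit (Fin N), K.IsOver B2 →
      K.size ≤ (2 * C ^ 2 + 1) * predSize d k S maxT + (9 * C ^ 2 + 3) →
        δ * 2 ^ N ≤ ((Finset.univ.filter fun v => K.eval v ≠ f v).card : ℝ)) :
    AvgHardAtLeast (ampFn e idx f) S := by
  classical
  intro C' hB hs
  by_contra hge
  rw [not_lt] at hge
  have hSR : (0 : ℝ) < S := by exact_mod_cast hS
  set ε : ℝ := 1 / S with hε
  have hεpos : 0 < ε := by positivity
  have hkεδ : 6 ≤ k * ε * δ := by
    rw [hε]
    have : (k : ℝ) * (1 / S) * δ = k * δ / S := by ring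
    rw [this, le_div_iff₀ hSR]
    linarith
  have hCεδ : 2 * k ≤ C * ε * δ := by
    rw [hε]
    have : (C : ℝ) * (1 / S) * δ = C * δ / S := by ring
    rw [this, le_div_iff₀ hSR]
    linarith
  -- the received word and its agreement with `Amp^f`
  have hsz : C'.size ≤ S := by exact_mod_cast hs
  have hG : CktSize B2 (fun s (_ : Unit) => Gb C' s) C'.size :=
    ((C'.cktSize_eval hB).rewire (ι' := Fin d ⊕ HBits N m) fun j => (sidx N d m).symm j).congr fun _ _ => rfl
  have hG' : CktSize B2 (fun s (_ : Unit) => Gb C' s) S := hG.of_le hsz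
  have hagree : (1 / 2 + ε) * Fintype.card (IWAmp.Seed N d m) ≤
      ((Finset.univ.filter fun σ : IWAmp.Seed N d m => Gb C' (encSeed σ) = IWAmp.amp e idx f σ).card : ℝ) := by
    rw [card_agree_seed, card_seed]
    unfold agreement at hge
    rw [Fintype.card_fun, Fintype.card_bool, Fintype.card_fin] at hge
    push_cast at hge ⊢
    rw [le_div_iff₀ (by positivity)] at hge
    rw [hε]
    linarith
  obtain ⟨K, hKB, hKs, hKerr⟩ := exists_circuit_of_agree e idx hidx f hεpos hδ hkεδ hCεδ hT (Gb C') hG' hagree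
  have := hmild K hKB hKs
  linarith

end IWAmpFn

end Literature.Computability.Complexity

end
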